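import Literature.NumberTheory.EllipticCurves.ZpExtensionRestrictLayerCompositum
import Literature.NumberTheory.EllipticCurves.ZpExtensionRestrictCyclotomic
import Literature.NumberTheory.GaloisRepresentations.InducedGaloisRep
import HarnessLib

set_option autoImplicit false

/-!
# Base change of a `ℤ_p`-extension along a finite `M/F` WITHOUT `M ∩ F_∞ = F`: the shifted extension
# `κ' = p^{-a}·(κ ∘ res)` of `M` (`M ∩ F_∞ = F_a`), its layers `M·F_{n+a}`, and cyclotomicity

Topic `Literature/NumberTheory/EllipticCurves` (companion of `ZpExtensionRestrict.lean`, `ZpExtensionRestrictLayers.lean`,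
`ZpExtensionRestrictLayerCompositum.lean`). THEOREM-ONLY file (no definition, no named fact, no `sorry`), written by the prover
seat `bsd-2adic-k4-w1` GEN 2 (cell `bsd-2adic`; supports stmt-BirchSwinnertonDyer-22615: the μ-descent `ℚ(W[2]) → ℚ(P)` of
`IwasawaTheory/ClassicalMuVanishesFiniteDescent.lean` in the sub-case `√2 ∈ ℚ(W[2])`, where `ℚ(W[2]) ∩ ℚ_∞ = ℚ_1`).

Washington, *Introduction to Cyclotomic Fields*, §13.1: for a `ℤ_p`-extension `F_∞/F` and a finite `M/F`, `M·F_∞/M` is a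
`ℤ_p`-extension whose group `Gal(M F_∞/M) ≅ Gal(F_∞/M ∩ F_∞)` has finite index `[M ∩ F_∞ : F] = p^a` in `Gal(F_∞/F)`;
its `n`-th layer is `M·F_{n+a}`.  The tree's `ZpExtension.restrict κ M h` is the case `a = 0` (`h` = surjectivity of
`κ ∘ res`).  Here the general case, WITHOUT a new definition: the shifted extension is produced existentially and
everything is proved from its defining identity `p^a · κ'(σ) = κ(res σ)`.

* §1 `exists_eq_toSubgroup_span_pow_of_isClosed` — a CLOSED subgroup of `(ℤ_p, +)` of finite index is `p^a ℤ_p` (a closed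
  subgroup is a `ℤ_p`-submodule by density of `ℤ`, `PadicInt.denseRange_intCast`; the ideals of `ℤ_p` are the `p^n ℤ_p`,
  `PadicInt.ideal_eq_span_pow_p`).
* §2 `exists_map_range_comp_absGaloisRestrict_eq` — the image `κ(res Γ_M) ≤ ℤ_p` is `p^a ℤ_p` for some `a` (closed: continuous
  image of the compact `Γ_M`; finite index dividing `[M : F]`, `nat_card_quotient_range_absGaloisRestrict`).
* §3 **`exists_zpExtension_shift`** — there are `a : ℕ` and a `ℤ_p`-extension `κ'` of `M` with
  `p^a · κ'(σ) = κ(res σ)` for all `σ ∈ Γ_M` (`κ' = p^{-a}(κ ∘ res)`; continuity through the closed embedding `y ↦ p^a y`).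
* §4 From the identity alone (`κ'` ANY `ℤ_p`-extension of `M` with `p^a · κ' = κ ∘ res`):
  `layerSubgroup_eq_comap_of_shift` (`Gal(M̄/M_n) = res⁻¹ Gal(F̄/F_{n+a})`), `kerSubgroup_eq_comap_of_shift`,
  **`isCyclotomic_of_shift`** (`κ` cyclotomic ⇒ `κ'` cyclotomic: both kernels are `χ_p⁻¹(μ(ℤ_p))`,
  `cyclotomicCharacter_absGaloisRestrict`).
* §5 For ANY `ℤ_p`-extension `κ'` of `M` whose `n`-th layer subgroup is `res⁻¹` of `κ`'s `m`-th (`restrict`: `m = n`; shift: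
  `m = n + a`): **`nonempty_ringEquiv_layer_fieldRange_sup_layer_of_layerSubgroup_eq`** — `κ'.layer n ≃+* ↥(j.fieldRange ⊔ κ.layer m)`
  for every `F`-embedding `j : M → F̄` (the `n`-th layer of `M·F_∞/M` is the compositum `j(M)·F_m`), and
  `natCard_classGroup_layer_eq_of_layerSubgroup_eq` (`#Cl(M_n) = #Cl(j(M)·F_m)`) — verbatim the `restrict` proofs of
  `ZpExtensionRestrictLayerCompositum.lean` with the layer index decoupled.

References: [Washington1997] L. Washington, *Introduction to Cyclotomic Fields*, 2nd ed., §13.1 (`K_∞ L / L`, `Gal ≅` an open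
subgroup of `ℤ_p`, layers `L K_n`); [NeukirchANT1999] Ch. IV §1; [MilneFT2022] Ch. 7; [Serre1973] II.3
(closed subgroups of `ℤ_p`).
-/

noncomputable section

open scoped NumberField

open Field IntermediateField Topology Literature.NumberTheory.GaloisRepresentations

universe u v

namespace Literature.NumberTheory.EllipticCurves.ZpExtension

/-! ### §1 Closed subgroups of finite index in `ℤ_p` are the `p^a ℤ_p` -/

/-- A CLOSED additive subgroup of `ℤ_p` is stable under multiplication by `ℤ_p` (the preimage of the subgroup under
`c ↦ c·x` is closed and contains the dense subring `ℤ`). [cite: Serre1973, Ch. II §3 (structure of ℤ_p and its closed subgroups)] -/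
theorem mul_mem_of_isClosed_addSubgroup {p : ℕ} [Fact p.Prime] (A : AddSubgroup ℤ_[p])
    (hA : IsClosed (A : Set ℤ_[p])) (c : ℤ_[p]) {x : ℤ_[p]} (hx : x ∈ A) : c * x ∈ A := by
  set S : Set ℤ_[p] := (fun d : ℤ_[p] => d * x) ⁻¹' (A : Set ℤ_[p]) with hS
  have hSc : IsClosed S := hA.preimage (continuous_id.mul continuous_const)
  have hsub : Set.range (Int.cast : ℤ → ℤ_[p]) ⊆ S := by
    rintro _ ⟨n, rfl⟩
    change (n : ℤ_[p]) * x ∈ A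
    rw [← zsmul_eq_mul]
    exact A.zsmul_mem hx n
  have hall : S = Set.univ := by
    apply Set.eq_univ_of_univ_subset
    rw [← (PadicInt.denseRange_intCast (p := p)).closure_range]
    exact hSc.closure_subset_iff.mpr hsub
  have : c ∈ S := by rw [hall]; exact Set.mem_univ c
  exact this

/-- **A closed subgroup of `ℤ_p` (written multiplicatively) of finite index is `p^a ℤ_p` for some `a`**: it is the
underlying group of a non-zero ideal of the DVR `ℤ_p` (`PadicInt.ideal_eq_span_pow_p`).
[cite: Serre1973, Ch. II §3 (structure of ℤ_p and its closed subgroups)] [cite: Washington1997, §13.1] -/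
theorem exists_eq_toSubgroup_span_pow_of_isClosed {p : ℕ} [Fact p.Prime] (H : Subgroup (Multiplicative ℤ_[p]))
    (hc : IsClosed (H : Set (Multiplicative ℤ_[p]))) (hi : H.index ≠ 0) :
    ∃ a : ℕ, H = AddSubgroup.toSubgroup (Ideal.span {(p : ℤ_[p]) ^ a}).toAddSubgroup := by
  set A : AddSubgroup ℤ_[p] := AddSubgroup.toSubgroup.symm H with hAdef
  have hmemA : ∀ x : ℤ_[p], x ∈ A ↔ Multiplicative.ofAdd x ∈ H := fun x => Iff.rfl
  have hAc : IsClosed (A : Set ℤ_[p]) := by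
    have : (A : Set ℤ_[p]) = Multiplicative.ofAdd ⁻¹' (H : Set (Multiplicative ℤ_[p])) := rfl
    rw [this]
    exact hc.preimage continuous_ofAdd
  -- the ideal with carrier `A`
  let I : Ideal ℤ_[p] :=
    { carrier := A
      add_mem' := fun ha hb => A.add_mem ha hb
      zero_mem' := A.zero_mem
      smul_mem' := fun c x hx => mul_mem_of_isClosed_addSubgroup A hAc c hx }
  have hI : ∀ x : ℤ_[p], x ∈ I ↔ x ∈ A := fun x => Iff.rfl
  -- `I ≠ ⊥`: `[ℤ_p : H] • 1 ∈ A` is non-zero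
  have hidx : Multiplicative.ofAdd ((H.index : ℤ_[p])) ∈ H := by
    have h1 := Subgroup.pow_index_mem H (Multiplicative.ofAdd (1 : ℤ_[p]))
    rwa [← ofAdd_nsmul, nsmul_eq_mul, mul_one] at h1
  have hI0 : I ≠ ⊥ := by
    intro h0
    have hmem : (H.index : ℤ_[p]) ∈ I := (hI _).mpr ((hmemA _).mpr hidx)
    rw [h0, Ideal.mem_bot] at hmem
    exact hi (by exact_mod_cast hmem)
  obtain ⟨a, ha⟩ := PadicInt.ideal_eq_span_pow_p hI0
  refine ⟨a, ?_⟩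
  ext x
  rw [← ofAdd_toAdd x]
  change Multiplicative.toAdd x ∈ A ↔ _
  rw [← hI, ha, Multiplicative.mem_toSubgroup, Submodule.mem_toAddSubgroup, toAdd_ofAdd]

/-! ### §2 The image `κ(res Γ_M) = p^a ℤ_p` -/

variable {F : Type u} [Field F] [NumberField F] {p : ℕ} [Fact p.Prime]

/-- **`κ(res Γ_M) = p^a ℤ_p` for some `a`** (`M/F` finite): the image is closed (continuous image of the compact `Γ_M`) and of
finite index dividing `[M : F]` (`[Γ_F : res Γ_M] = [M : F]`, `nat_card_quotient_range_absGaloisRestrict`; `κ` onto).  The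
exponent `a` is `[M ∩ F_∞ : F] = p^a`. [cite: Washington1997, §13.1] [cite: NeukirchANT1999, Ch. IV §1] -/
theorem exists_map_range_comp_absGaloisRestrict_eq (κ : ZpExtension F p) (M : Type v) [Field M] [NumberField M]
    [Algebra F M] :
    ∃ a : ℕ, ((absGaloisRestrict F M).range).map κ.toContinuousMonoidHom.toMonoidHom =
      AddSubgroup.toSubgroup (Ideal.span {(p : ℤ_[p]) ^ a}).toAddSubgroup := by
  haveI : FiniteDimensional F M := Module.Finite.of_restrictScalars_finite ℚ F M
  set H := ((absGaloisRestrict F M).range).map κ.toContinuousMonoidHom.toMonoidHom with hH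
  -- closed: range of the continuous `κ ∘ res` on the compact `Γ_M`
  have hrange : (H : Set (Multiplicative ℤ_[p])) =
      Set.range (κ.toContinuousMonoidHom.comp (absGaloisRestrict F M)) := by
    rw [hH, MonoidHom.map_range]
    rfl
  have hc : IsClosed (H : Set (Multiplicative ℤ_[p])) := by
    rw [hrange]
    exact (isCompact_range (κ.toContinuousMonoidHom.comp (absGaloisRestrict F M)).continuous).isClosed
  -- finite index
  have hHidx : ((absGaloisRestrict F M).range).index = Module.finrank F M := nat_card_quotient_range_absGaloisRestrict F M
  have hdvd : H.index ∣ Module.finrank F M := hHidx ▸ Subgroup.index_map_dvd _ κ.surjective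
  have hi : H.index ≠ 0 := fun h0 => Module.finrank_pos.ne' (zero_dvd_iff.mp (h0 ▸ hdvd))
  exact exists_eq_toSubgroup_span_pow_of_isClosed H hc hi

/-! ### §3 The shifted `ℤ_p`-extension `κ' = p^{-a}·(κ ∘ res)` of `M` -/

/-- **The base change of `κ` to ANY finite `M/F`**: there are `a : ℕ` and a `ℤ_p`-extension `κ'` of `M` (the tower
`M·F_∞/M`, `Gal(M F_∞/M) ≅ p^a ℤ_p ≅ ℤ_p`) with `p^a · κ'(σ) = κ(res σ)` for every `σ ∈ Γ_M`.  For `a = 0` this is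
`κ.restrict`; in general `M ∩ F_∞ = F_a`.  (Division by `p^a` on `p^a ℤ_p = κ(res Γ_M)`; continuity because `y ↦ p^a y` is a
closed embedding of the compact `ℤ_p`.) [cite: Washington1997, §13.1] -/
theorem exists_zpExtension_shift (κ : ZpExtension F p) (M : Type v) [Field M] [NumberField M] [Algebra F M] :
    ∃ (a : ℕ) (κ' : ZpExtension M p), ∀ σ : absoluteGaloisGroup M,
      (p : ℤ_[p]) ^ a * (κ' σ).toAdd = (κ (absGaloisRestrict F M σ)).toAdd := by
  obtain ⟨a, ha⟩ := exists_map_range_comp_absGaloisRestrict_eq κ M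
  have hpa : ((p : ℤ_[p]) ^ a) ≠ 0 := pow_ne_zero _ (Nat.cast_ne_zero.mpr (Fact.out : p.Prime).ne_zero)
  -- every `κ(res σ)` is divisible by `p^a`
  have hdiv : ∀ σ : absoluteGaloisGroup M, ∃ y : ℤ_[p], (κ (absGaloisRestrict F M σ)).toAdd = (p : ℤ_[p]) ^ a * y := by
    intro σ
    have hmem : κ (absGaloisRestrict F M σ) ∈
        ((absGaloisRestrict F M).range).map κ.toContinuousMonoidHom.toMonoidHom :=
      ⟨absGaloisRestrict F M σ, ⟨σ, rfl⟩, rfl⟩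
    rw [ha, Multiplicative.mem_toSubgroup, Submodule.mem_toAddSubgroup, Ideal.mem_span_singleton] at hmem
    exact hmem
  choose f hf using hdiv
  -- `f` is a group homomorphism
  have hf1 : f 1 = 0 := by
    have h := hf 1
    rw [map_one, map_one, toAdd_one] at h
    rcases mul_eq_zero.mp h.symm with h0 | h0
    · exact absurd h0 hpa
    · exact h0
  have hfmul : ∀ σ τ, f (σ * τ) = f σ + f τ := by
    intro σ τ
    apply mul_left_cancel₀ hpa
    rw [mul_add, ← hf σ, ← hf τ, ← hf (σ * τ), map_mul, map_mul, toAdd_mul]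
  -- continuity: `p^a · f = toAdd ∘ κ ∘ res` is continuous and `y ↦ p^a y` is a closed embedding
  have hm : IsClosedEmbedding (fun y : ℤ_[p] => (p : ℤ_[p]) ^ a * y) :=
    (continuous_const.mul continuous_id).isClosedEmbedding (mul_right_injective₀ hpa)
  have hfc : Continuous f := by
    rw [hm.isEmbedding.continuous_iff]
    have hc : Continuous (fun σ : absoluteGaloisGroup M => (κ (absGaloisRestrict F M σ)).toAdd) :=
      continuous_toAdd.comp (κ.toContinuousMonoidHom.comp (absGaloisRestrict F M)).continuous
    convert hc using 1
    ext σ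
    exact (hf σ).symm
  let g : absoluteGaloisGroup M →ₜ* Multiplicative ℤ_[p] :=
    { toFun := fun σ => Multiplicative.ofAdd (f σ)
      map_one' := by rw [hf1]; rfl
      map_mul' := fun σ τ => by rw [hfmul, ofAdd_add]
      continuous_toFun := continuous_ofAdd.comp hfc }
  have hg : ∀ σ, g σ = Multiplicative.ofAdd (f σ) := fun σ => rfl
  -- surjectivity: `p^a y ∈ p^a ℤ_p = κ(res Γ_M)`
  have hsurj : Function.Surjective g := by
    intro y
    have hmem : Multiplicative.ofAdd ((p : ℤ_[p]) ^ a * y.toAdd) ∈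
        ((absGaloisRestrict F M).range).map κ.toContinuousMonoidHom.toMonoidHom := by
      rw [ha, Multiplicative.mem_toSubgroup, Submodule.mem_toAddSubgroup, toAdd_ofAdd, Ideal.mem_span_singleton]
      exact Dvd.intro _ rfl
    obtain ⟨_, ⟨σ, rfl⟩, hσ⟩ := hmem
    refine ⟨σ, ?_⟩
    rw [hg, ← ofAdd_toAdd y]
    congr 1
    apply mul_left_cancel₀ hpa
    rw [← hf σ]
    have h := congrArg Multiplicative.toAdd hσ
    rw [toAdd_ofAdd] at h
    exact h
  refine ⟨a, ⟨g, hsurj⟩, fun σ => ?_⟩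
  change (p : ℤ_[p]) ^ a * (Multiplicative.ofAdd (f σ)).toAdd = _
  rw [toAdd_ofAdd, ← hf σ]

/-! ### §4 Consequences of the shift identity: layer subgroups, kernel, cyclotomicity -/

section Shift

variable (κ : ZpExtension F p) (M : Type v) [Field M] [NumberField M] [Algebra F M] {a : ℕ}
  (κ' : ZpExtension M p)
  (hs : ∀ σ : absoluteGaloisGroup M, (p : ℤ_[p]) ^ a * (κ' σ).toAdd = (κ (absGaloisRestrict F M σ)).toAdd)

include hs

omit [NumberField F] [NumberField M] in
/-- **`Gal(M̄/M_n) = res⁻¹ Gal(F̄/F_{n+a})`** for the shifted extension: `p^n ∣ κ'(σ) ⟺ p^{n+a} ∣ p^a κ'(σ) = κ(res σ)`.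
[cite: Washington1997, §13.1] -/
theorem layerSubgroup_eq_comap_of_shift (n : ℕ) :
    κ'.layerSubgroup n = (κ.layerSubgroup (n + a)).comap (absGaloisRestrict F M).toMonoidHom := by
  have hpa : ((p : ℤ_[p]) ^ a) ≠ 0 := pow_ne_zero _ (Nat.cast_ne_zero.mpr (Fact.out : p.Prime).ne_zero)
  ext σ
  rw [mem_layerSubgroup, Subgroup.mem_comap, mem_layerSubgroup]
  change _ ↔ (p : ℤ_[p]) ^ (n + a) ∣ (κ (absGaloisRestrict F M σ)).toAdd
  rw [← hs σ, pow_add, mul_comm ((p : ℤ_[p]) ^ n), mul_dvd_mul_iff_left hpa]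

omit [NumberField F] [NumberField M] in
/-- `ker κ' = res⁻¹(ker κ)` for the shifted extension (`κ'(σ) = 0 ⟺ p^a κ'(σ) = 0`): the tower of `κ'` is `M·F_∞`.
[cite: Washington1997, §13.1] -/
theorem kerSubgroup_eq_comap_of_shift :
    κ'.kerSubgroup = κ.kerSubgroup.comap (absGaloisRestrict F M).toMonoidHom := by
  have hpa : ((p : ℤ_[p]) ^ a) ≠ 0 := pow_ne_zero _ (Nat.cast_ne_zero.mpr (Fact.out : p.Prime).ne_zero)
  ext σ
  rw [mem_kerSubgroup, Subgroup.mem_comap]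
  change _ ↔ κ (absGaloisRestrict F M σ) = 1
  rw [← toAdd_eq_zero, ← toAdd_eq_zero, ← hs σ]
  constructor
  · intro h; rw [h, mul_zero]
  · intro h
    rcases mul_eq_zero.mp h with h0 | h0
    · exact absurd h0 hpa
    · exact h0

omit [NumberField M] in
/-- **The shifted extension of a cyclotomic `κ` is cyclotomic**: `ker κ' = res⁻¹(χ_{p,F}⁻¹(μ(ℤ_p))) = χ_{p,M}⁻¹(μ(ℤ_p))`
(`cyclotomicCharacter_absGaloisRestrict`), i.e. `M·F_∞^{cyc} = M_∞^{cyc}` whatever `M ∩ F_∞` is. [cite: Washington1997, §13.1] -/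
theorem isCyclotomic_of_shift [NumberField M] (hκ : κ.IsCyclotomic) : κ'.IsCyclotomic := by
  haveI : NeZero (p : F) := ⟨Nat.cast_ne_zero.mpr (Fact.out : p.Prime).ne_zero⟩
  unfold IsCyclotomic at hκ ⊢
  rw [kerSubgroup_eq_comap_of_shift κ M κ' hs, hκ, Subgroup.comap_comap]
  congr 1
  exact MonoidHom.ext fun σ => cyclotomicCharacter_absGaloisRestrict F M p σ

end Shift

/-! ### §5 Layers of any `κ'` with `κ'.layerSubgroup n = res⁻¹(κ.layerSubgroup m)`: `M_n ≅ j(M)·F_m` -/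

section Layers

omit [NumberField F] in
/-- Membership in a layer: `x ∈ K_n ↔ τ • x = x` for all `τ ∈ κ⁻¹(pⁿℤ_p)`. [cite: Washington1997, §13.1] -/
private theorem mem_layer_iff_smul' {K : Type v} [Field K] (κ : ZpExtension K p) (n : ℕ)
    (x : AlgebraicClosure K) : x ∈ κ.layer n ↔ ∀ τ ∈ κ.layerSubgroup n, τ • x = x := by
  rw [layer, IntermediateField.mem_fixedField_iff]
  constructor
  · intro h τ hτ
    exact h _ ⟨τ, hτ, rfl⟩
  · rintro h f ⟨τ, hτ, rfl⟩
    exact h τ hτ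

variable (κ : ZpExtension F p) (M : Type v) [Field M] [NumberField M] [Algebra F M] (κ' : ZpExtension M p)
  {n m : ℕ} (hnm : κ'.layerSubgroup n = (κ.layerSubgroup m).comap (absGaloisRestrict F M).toMonoidHom)

include hnm

/-- **`ι y ∈ M_n` iff `y` is fixed by `res(Γ_M) ∩ κ⁻¹(p^m ℤ_p)`**, for the chosen `ι : F̄ ≅ M̄` (`absClosureEquiv`), whenever
`Gal(M̄/M_n) = res⁻¹ Gal(F̄/F_m)` — the `restrict` case `m = n` is `absClosureEquiv_mem_layer_restrict_iff`.
[cite: Washington1997, §13.1] -/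
theorem absClosureEquiv_mem_layer_iff_of_layerSubgroup_eq (y : AlgebraicClosure F) :
    absClosureEquiv F M y ∈ κ'.layer n ↔
      ∀ τ : absoluteGaloisGroup M, absGaloisRestrict F M τ ∈ κ.layerSubgroup m →
        absGaloisRestrict F M τ • y = y := by
  rw [mem_layer_iff_smul', hnm]
  refine forall_congr' fun τ => ?_
  rw [Subgroup.mem_comap]
  refine imp_congr Iff.rfl ?_
  rw [absClosureEquiv_apply, ← absGaloisRestrict_apply_smul]
  exact (absClosureEmbedding_bijective F M).1.eq_iff

/-- **`M_n ≅ e(M)·F_m`** as rings (copy `e = absEmbedding F M`) whenever `Gal(M̄/M_n) = res⁻¹ Gal(F̄/F_m)`: the two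
membership criteria (`mem_fieldRange_sup_layer_iff`, the previous lemma) coincide along `ι : F̄ ≅ M̄`.
[cite: Washington1997, §13.1] -/
theorem nonempty_ringEquiv_fieldRange_sup_layer_layer_of_layerSubgroup_eq :
    Nonempty (↥((absEmbedding F M).fieldRange ⊔ κ.layer m) ≃+* ↥(κ'.layer n)) := by
  set θ := absClosureEquiv F M with hθ
  have hmem : ∀ y : AlgebraicClosure F,
      y ∈ (absEmbedding F M).fieldRange ⊔ κ.layer m ↔ θ y ∈ κ'.layer n := fun y =>
    (mem_fieldRange_sup_layer_iff κ M m y).trans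
      (absClosureEquiv_mem_layer_iff_of_layerSubgroup_eq κ M κ' hnm y).symm
  have hmem' : ∀ x : AlgebraicClosure M,
      x ∈ κ'.layer n ↔ θ.symm x ∈ (absEmbedding F M).fieldRange ⊔ κ.layer m := fun x => by
    rw [hmem, θ.apply_symm_apply]
  exact ⟨{ toFun := fun y => ⟨θ y, (hmem y).mp y.2⟩
           invFun := fun x => ⟨θ.symm x, (hmem' x).mp x.2⟩
           left_inv := fun y => Subtype.ext (θ.symm_apply_apply y)
           right_inv := fun x => Subtype.ext (θ.apply_symm_apply x)
           map_mul' := fun y y' => Subtype.ext (map_mul θ y.1 y'.1)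
           map_add' := fun y y' => Subtype.ext (map_add θ y.1 y'.1) }⟩

/-- **The `n`-th layer of `κ'` is the compositum `j(M)·F_m ⊆ F̄` for EVERY `F`-embedding `j : M → F̄`** whenever
`Gal(M̄/M_n) = res⁻¹ Gal(F̄/F_m)` (any other `j` is conjugate to `absEmbedding` by `Gal(F̄/F)`, which preserves `F_m`).
[cite: Washington1997, §13.1] [cite: MilneFT2022, Ch. 7 (embeddings into the algebraic closure are conjugate under the absolute Galois group)] -/
theorem nonempty_ringEquiv_layer_fieldRange_sup_layer_of_layerSubgroup_eq (j : M →ₐ[F] AlgebraicClosure F) :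
    Nonempty (↥(κ'.layer n) ≃+* ↥(j.fieldRange ⊔ κ.layer m)) := by
  haveI : FiniteDimensional F M := Module.Finite.of_restrictScalars_finite ℚ F M
  obtain ⟨e₁⟩ := nonempty_ringEquiv_fieldRange_sup_layer_layer_of_layerSubgroup_eq κ M κ' hnm
  obtain ⟨τ, hτ⟩ := exists_algEquiv_apply_eq (absEmbedding F M) j
  obtain ⟨e₂⟩ := nonempty_algEquiv_fieldRange_sup_layer_of_apply_eq κ (absEmbedding F M) j τ hτ m
  exact ⟨e₁.symm.trans e₂.toRingEquiv⟩

/-- **`#Cl(M_n) = #Cl(j(M)·F_m)`** whenever `Gal(M̄/M_n) = res⁻¹ Gal(F̄/F_m)` (class groups along a ring isomorphism).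
[cite: Washington1997, §13.1] -/
theorem natCard_classGroup_layer_eq_of_layerSubgroup_eq (j : M →ₐ[F] AlgebraicClosure F) :
    Nat.card (ClassGroup (𝓞 ↥(κ'.layer n))) = Nat.card (ClassGroup (𝓞 ↥(j.fieldRange ⊔ κ.layer m))) := by
  obtain ⟨e⟩ := nonempty_ringEquiv_layer_fieldRange_sup_layer_of_layerSubgroup_eq κ M κ' hnm j
  exact Nat.card_congr (ClassGroup.mulEquiv (NumberField.RingOfIntegers.mapRingEquiv e)).toEquiv

end Layers

end Literature.NumberTheory.EllipticCurves.ZpExtension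

end
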